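import Mathlib

/-!
# Imbrie (2016), three-spin block: the SPREAD LAW across the diagonal on the face `t₂ = 0`

[cite: ImbrieJSP2016, eq. (1.1), assumption LLA(ν, C)]  Repair cell b2b-imbrie, LLA.md block O,
O5(j).  On the face `t₂ = 0` (middle spin frozen at `s`), the end spins are dressed two-level
systems `u Z + t X` with `r = √(u² + t²)`; the two dressed states put weight `(1 ± u/r)/2` on
`σ = +`, so a bond cell containing that spin separates the flat-pair partners
`|ε₁ = ±⟩|s⟩|ε₃ = ∓⟩` at first-order speed ("spread") `|u|/r₁` (bond 1) resp. `|v|/r₃` (bond 2).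
On the resonance `r₁ = r₃`, i.e. `u² + t₁² = v² + t₃²`, the larger of the two squared spreads is at
least `1 − (min(t₁,t₃)/max(t₁,t₃))² = (t₁+t₃)|t₁−t₃| / max(t₁,t₃)²` — the face law
`G_face(θ) ≍ √(2θ/t)`, `θ = |t₁ − t₃|`, whose reciprocal is integrable across the diagonal.
Elementary real algebra; no spectral theory is invoked (the eigenvector is exhibited).
-/

namespace Literature.MathematicalPhysics.QuantumLattice.Imbrie2016

namespace FaceSpreadLaw

/-- [cite: ImbrieJSP2016, eq. (1.1)] the dressed qubit `u Z + t X` as a real 2×2 matrix. -/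
def qubit (u t : ℝ) : Matrix (Fin 2) (Fin 2) ℝ := !![u, t; t, -u]

/-- [cite: ImbrieJSP2016, eq. (1.1)] `(t, r − u)` is an eigenvector of the dressed qubit with
eigenvalue `r = √(u² + t²)` (un-normalised; nonzero as soon as `t ≠ 0`). -/
theorem qubit_eigenvector (u t : ℝ) :
    (qubit u t).mulVec ![t, Real.sqrt (u ^ 2 + t ^ 2) - u] =
      Real.sqrt (u ^ 2 + t ^ 2) • ![t, Real.sqrt (u ^ 2 + t ^ 2) - u] := by
  have hr : Real.sqrt (u ^ 2 + t ^ 2) ^ 2 = u ^ 2 + t ^ 2 := Real.sq_sqrt (by positivity)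
  ext i; fin_cases i <;> simp [qubit, Matrix.mulVec, dotProduct, Fin.sum_univ_two] <;> nlinarith [hr]

/-- [cite: ImbrieJSP2016, eq. (1.1)] `(r − u, −t)` is an eigenvector with eigenvalue `−r`. -/
theorem qubit_eigenvector_neg (u t : ℝ) :
    (qubit u t).mulVec ![Real.sqrt (u ^ 2 + t ^ 2) - u, -t] =
      (-Real.sqrt (u ^ 2 + t ^ 2)) • ![Real.sqrt (u ^ 2 + t ^ 2) - u, -t] := by
  have hr : Real.sqrt (u ^ 2 + t ^ 2) ^ 2 = u ^ 2 + t ^ 2 := Real.sq_sqrt (by positivity)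
  ext i; fin_cases i <;> simp [qubit, Matrix.mulVec, dotProduct, Fin.sum_univ_two] <;> nlinarith [hr]

/-- [cite: ImbrieJSP2016, eq. (1.1)] DRESSED WEIGHTS: the normalised `σ = +` weight of the
`+r` eigenvector `(t, r − u)` is `(1 + u/r)/2` (for `t ≠ 0`). -/
theorem dressed_weight_plus (u t : ℝ) (ht : t ≠ 0) :
    t ^ 2 / (t ^ 2 + (Real.sqrt (u ^ 2 + t ^ 2) - u) ^ 2) =
      (1 + u / Real.sqrt (u ^ 2 + t ^ 2)) / 2 := by
  set r := Real.sqrt (u ^ 2 + t ^ 2) with hr_def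
  have hr : r ^ 2 = u ^ 2 + t ^ 2 := Real.sq_sqrt (by positivity)
  have ht2 : 0 < t ^ 2 := by positivity
  have hru : u < r := by
    have habs : |u| < r := by
      rw [hr_def, ← Real.sqrt_sq_eq_abs]
      exact Real.sqrt_lt_sqrt (sq_nonneg u) (by linarith)
    exact lt_of_le_of_lt (le_abs_self u) habs
  have hr0 : 0 < r := by
    rw [hr_def]; exact Real.sqrt_pos.mpr (by positivity)
  have hden : t ^ 2 + (r - u) ^ 2 = 2 * r * (r - u) := by nlinarith [hr]
  rw [hden, div_eq_div_iff (by nlinarith [hr0, hru]) (by norm_num)]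
  field_simp
  nlinarith [hr]

/-- [cite: ImbrieJSP2016, eq. (1.1)] the `σ = +` weight of the `−r` eigenvector `(r − u, −t)` is
`(1 − u/r)/2`; hence the bond-cell SPREAD between the two dressed states is `|u|/r`. -/
theorem dressed_weight_minus (u t : ℝ) (ht : t ≠ 0) :
    (Real.sqrt (u ^ 2 + t ^ 2) - u) ^ 2 / ((Real.sqrt (u ^ 2 + t ^ 2) - u) ^ 2 + t ^ 2) =
      (1 - u / Real.sqrt (u ^ 2 + t ^ 2)) / 2 := by
  have h := dressed_weight_plus u t ht
  have hpos : 0 < t ^ 2 + (Real.sqrt (u ^ 2 + t ^ 2) - u) ^ 2 := by positivity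
  have hsum : t ^ 2 / (t ^ 2 + (Real.sqrt (u ^ 2 + t ^ 2) - u) ^ 2) +
      (Real.sqrt (u ^ 2 + t ^ 2) - u) ^ 2 / ((Real.sqrt (u ^ 2 + t ^ 2) - u) ^ 2 + t ^ 2) = 1 := by
    rw [add_comm ((Real.sqrt (u ^ 2 + t ^ 2) - u) ^ 2) (t ^ 2), ← add_div, div_self hpos.ne']
  linarith

/-- [cite: ImbrieJSP2016, eq. (1.1)] the squared spread `(u/r)² = u²/(u²+t²)`. -/
theorem spread_sq (u t : ℝ) (ht : t ≠ 0) :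
    (u / Real.sqrt (u ^ 2 + t ^ 2)) ^ 2 = u ^ 2 / (u ^ 2 + t ^ 2) := by
  rw [div_pow, Real.sq_sqrt (by positivity)]

/-- [cite: ImbrieJSP2016, eq. (1.1)] THE FACE SPREAD LAW: on the flat-pair resonance
`u² + t₁² = v² + t₃²` (i.e. `r₁ = r₃`) with `0 < t₁ ≤ t₃`, the bond-1 squared spread obeys
`u²/(u²+t₁²) ≥ (t₃² − t₁²)/t₃² = 1 − (t₁/t₃)²`. -/
theorem face_spread_law (u v t₁ t₃ : ℝ) (h₁ : 0 < t₁) (h₁₃ : t₁ ≤ t₃)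
    (hres : u ^ 2 + t₁ ^ 2 = v ^ 2 + t₃ ^ 2) :
    (t₃ ^ 2 - t₁ ^ 2) / t₃ ^ 2 ≤ u ^ 2 / (u ^ 2 + t₁ ^ 2) := by
  have h₃ : 0 < t₃ := lt_of_lt_of_le h₁ h₁₃
  rw [div_le_div_iff₀ (by positivity) (by positivity)]
  nlinarith [sq_nonneg v, sq_nonneg t₁, mul_nonneg (sq_nonneg t₁) (sq_nonneg v)]

/-- [cite: ImbrieJSP2016, eq. (1.1)] the symmetric case `0 < t₃ ≤ t₁`: the bond-2 squared spread
`v²/(v²+t₃²) ≥ (t₁² − t₃²)/t₁²`.  Together: `max spread² ≥ (t₁+t₃)|t₁−t₃|/max(t₁,t₃)²`. -/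
theorem face_spread_law' (u v t₁ t₃ : ℝ) (h₃ : 0 < t₃) (h₃₁ : t₃ ≤ t₁)
    (hres : u ^ 2 + t₁ ^ 2 = v ^ 2 + t₃ ^ 2) :
    (t₁ ^ 2 - t₃ ^ 2) / t₁ ^ 2 ≤ v ^ 2 / (v ^ 2 + t₃ ^ 2) :=
  face_spread_law v u t₃ t₁ h₃ h₃₁ hres.symm

/-- [cite: ImbrieJSP2016, eq. (1.1)] the law is SHARP: equality at `v = 0`, `u² = t₃² − t₁²`. -/
theorem face_spread_law_sharp (t₁ t₃ : ℝ) (h₁ : 0 < t₁) (h₁₃ : t₁ ≤ t₃) :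
    let u := Real.sqrt (t₃ ^ 2 - t₁ ^ 2)
    u ^ 2 + t₁ ^ 2 = (0 : ℝ) ^ 2 + t₃ ^ 2 ∧ u ^ 2 / (u ^ 2 + t₁ ^ 2) = (t₃ ^ 2 - t₁ ^ 2) / t₃ ^ 2 := by
  have hk : 0 ≤ t₃ ^ 2 - t₁ ^ 2 := by nlinarith
  have hu : Real.sqrt (t₃ ^ 2 - t₁ ^ 2) ^ 2 = t₃ ^ 2 - t₁ ^ 2 := Real.sq_sqrt hk
  refine ⟨by rw [hu]; ring, ?_⟩
  rw [hu]; congr 1; ring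

end FaceSpreadLaw

end Literature.MathematicalPhysics.QuantumLattice.Imbrie2016
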